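import Summits.MatrixMultiplication.MatrixMultiplication.Theorems.OutsiderSandwichToricCeilingPowTwoCwBaseDataD

/-!
# OutsiderSandwich — toric ceiling of `cw₂^{⊠N}`: the `N = 3` two-cw base census, kernel checks D
(groups `cX9`, `cX10`, `cX11`; decomp-mm lens 4, gen 47, kernel K47-6 census D; THESES-FREE, `ω`-free;
helper toward `LaserTangency`, stmt-32268)

LABEL.  TORIC · FINITE (`N = 3`) · NEC-side instrument.  `check cXk datak = true`
(`…TwoCwBaseDefs.check`: the certificate list has the length of the instance list and every
certificate decodes to a `valid` perfect matching of `cw ⊠ cw ⊠ D` minus its instance), decided in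
the kernel (`decide +kernel`, standard axioms; no `native_decide`, no `ofReduceBool`).  Consumed by
`…TwoCwBase.census_all`.  WHAT THIS IS NOT: no statement about tensors or `ω`.
-/

set_option linter.dupNamespace false
set_option maxRecDepth 200000
set_option Elab.async false

namespace Summit.MatrixMultiplication.MatrixMultiplication.Theorems.OutsiderSandwichToricCeilingPowTwoCwBaseCensusD

open Summit.MatrixMultiplication.MatrixMultiplication.Theorems.OutsiderSandwichToricCeilingPowTwoCwBaseDefs
open Summit.MatrixMultiplication.MatrixMultiplication.Theorems.OutsiderSandwichToricCeilingPowTwoCwBaseDataD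

set_option maxHeartbeats 0 in
/-- CENSUS, group `cX9` (318 instances; kernel-decided): every certificate of `data9` decodes
to a valid perfect matching of its instance. -/
theorem census9 : check cX9 data9 = true := by
  decide +kernel

set_option maxHeartbeats 0 in
/-- CENSUS, group `cX10` (324 instances; kernel-decided): every certificate of `data10` decodes
to a valid perfect matching of its instance. -/
theorem census10 : check cX10 data10 = true := by
  decide +kernel

set_option maxHeartbeats 0 in
/-- CENSUS, group `cX11` (208 instances; kernel-decided): every certificate of `data11` decodes
to a valid perfect matching of its instance. -/
theorem census11 : check cX11 data11 = true := by
  decide +kernel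

end Summit.MatrixMultiplication.MatrixMultiplication.Theorems.OutsiderSandwichToricCeilingPowTwoCwBaseCensusD
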